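import Summits.FinalStateConjecture.FinalStateConjecture.Theses.KerrnessPropagates
import Summits.FinalStateConjecture.FinalStateConjecture.Theorems.KerrnessPropagatesKerrBasinCaptureDefs
import Summits.FinalStateConjecture.FinalStateConjecture.Theorems.KerrnessPropagatesKerrBasinCaptureStubMarginCompactness
import Summits.FinalStateConjecture.FinalStateConjecture.Theorems.KerrnessPropagatesKerrBasinCaptureStubSlabTransferFinal
import Literature.Geometry.Lorentzian.TameGenericityDiagonal

/-!
# Route `KerrnessPropagates`, crux `KerrBasinCapture` (stmt-FinalStateConjecture-17646), line `registered` —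
# the crux from TAME WEAK COSMIC CENSORSHIP and CAPTURE ALONG CENSORED CURVES (the line's composition, sorry-free)

The line `registered` (skeleton `Cruxes/KerrBasinCapture/Lines/birth.lean`, rev 12) closes the crux modulo two
registered stubs. This file lands its COMPOSITION as an unconditional theorem of the tree, with the two open
statements as explicit hypotheses, so that the reduction no longer lives only in the Cruxes workfile:

* `fixedRecurrence_of_floatingRecurrence` — CHARGE STABILISATION, pointwise in the datum and the development,
  equation-free: floating recurrence with margins `(N₀, m₀, χ < 1, μ, v₀, L₀)` (hole count, masses, spins, inner
  radii and boosts of the `ε`-configurations range in one compact margin family, pairwise lab velocities `≥ v₀`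
  apart) implies recurrence to ONE FIXED sub-extremal configuration with inner radii in `(r₋, r₊)` — verbatim
  conjunct (ii) of the crux. Proof: configurations at accuracies `1/(n+1)`; the margin family is compact
  (`stub_marginCompactness`, landed p149657) so a constant-`N` subsequence converges to a limit in the margins;
  fix `pₗ = (N; Mₗ, aₗ, lim r₀ + μ/2; moₗ)`; slabs of the `n`-th configuration at small accuracy and late time are
  slabs of `pₗ` at the target accuracy (`stub_slabTransferFinal`, landed p167971 with its thirteen helpers).
* `kerrBasinCapture_of_censorship_of_captureAlongCensoredCurves` — THE CRUX from (1) tame weak cosmic censorship,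
  stated VERBATIM as the body of the registered open item `Theses.PhaseMixingCapture.WeakCosmicCensorshipTame`
  (stmt-FinalStateConjecture-17269: tame-generically an MGHD exists and every MGHD has complete `𝓘⁺`), and (2)
  CAPTURE ALONG CENSORED CURVES: along every tame curve of admissible data on an end `e` (immersed and injective,
  or constant) whose members off `0` are censored and whose base datum is exceptional for
  `Q_k` = "every MGHD has complete `𝓘⁺`, recurs with margins (floating charges) in the one-chart `Cᵏ` slab sense,
  and satisfies the interior lemma", there pass an end `e'` and a tame, injective, immersed curve of admissible
  data through the base datum whose members off `0` satisfy `Q_k`. Proof: tame genericity COMPOSES ALONG CURVES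
  (`InitialDataSet.isTameChristodoulouGeneric_of_relative_exceptional`, `TameGenericityDiagonal.lean`; constant
  curves are tame because admissible data have a sole Dafermos–Rodnianski-flat end), giving tame genericity of
  `Q_k`; then monotonicity of tame genericity in the property (`IsTameChristodoulouGeneric.mono`) with charge
  stabilisation. By `InitialDataSet.isTameChristodoulouGeneric_iff_relative_exceptional` hypothesis (2) is, given
  (1), EQUIVALENT to tame genericity of `Q_k`: the factorisation loses nothing. Both hypotheses are open problems
  (weak cosmic censorship; the large-data final state of censored developments in recurrence form) — this file
  proves the glue, not them.
-/

open scoped Manifold ContDiff Topology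
open Filter Set Function TopologicalSpace
open Literature.Geometry.Lorentzian

-- D-0017: single-problem summit, `Summit.<S>.<S>.…` by design.
set_option linter.dupNamespace false

namespace Summit.FinalStateConjecture.FinalStateConjecture.Theorems.KerrnessPropagates.KerrBasinCapture

/-- **Charge stabilisation** (pointwise in the datum and the development, equation-free): floating recurrence
with margins — for some margin family `(N₀, m₀, χ < 1, μ, v₀, L₀)` and every accuracy `ε > 0` a configuration
`(N; M, a, r₀; mo)` in the margins (`InMargins`) to which the development recurs at accuracy `ε` beyond every lab
time in the one-chart slab sense (`SlabAt`) — implies recurrence to ONE FIXED configuration, sub-extremal with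
inner radii in `(r₋, r₊)`, at every accuracy: compactness of the margin family (`stub_marginCompactness`) and
re-anchoring of late, accurate slabs of a convergent sequence of configurations to its limit
(`stub_slabTransferFinal`). -/
theorem fixedRecurrence_of_floatingRecurrence (k : ℕ) {X : Type} [TopologicalSpace X] [ChartedSpace E3 X]
    [IsManifold (𝓡 3) (⊤ : ℕ∞) X] [T2Space X] [SecondCountableTopology X] [ConnectedSpace X]
    {D : InitialDataSet (𝓡 3) X} (𝒟 : VacuumCauchyDevelopment D)
    (hfloat : ∃ (N₀ : ℕ) (m₀ χ μ v₀ L₀ : ℝ), 0 < m₀ ∧ χ < 1 ∧ 0 < μ ∧ 0 < v₀ ∧ ∀ ε : ℝ, 0 < ε → ∃ (N : ℕ) (M a r₀ : Fin N → ℝ) (mo : Fin N → ↥lorentzGroup × E4), InMargins N₀ m₀ χ μ v₀ L₀ N M a r₀ mo ∧ ∀ τ₁ : ℝ, ∃ τ : ℝ, τ₁ ≤ τ ∧ SlabAt k 𝒟 N M a r₀ mo ε τ) :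
    ∃ (N : ℕ) (M a r₀ : Fin N → ℝ) (mo : Fin N → ↥lorentzGroup × E4), (∀ i, Kerr.IsSubextremal (M i) (a i) ∧ r₀ i ∈ Ioo (Kerr.rMinus (M i) (a i)) (Kerr.rPlus (M i) (a i))) ∧ ∀ ε : ℝ, 0 < ε → ∀ τ₁ : ℝ, ∃ τ : ℝ, τ₁ ≤ τ ∧ SlabAt k 𝒟 N M a r₀ mo ε τ := by
  have hT1 : ∀ (N₀ : ℕ) (m₀ χ μ v₀ L₀ : ℝ) (s : ℕ → (Σ N : ℕ, (Fin N → ℝ) × (Fin N → ℝ) × (Fin N → ℝ) × (Fin N → ↥lorentzGroup × E4))), (∀ n, InMargins N₀ m₀ χ μ v₀ L₀ (s n).1 (s n).2.1 (s n).2.2.1 (s n).2.2.2.1 (s n).2.2.2.2) → ∃ (N : ℕ) (M a r₀ : ℕ → Fin N → ℝ) (mo : ℕ → Fin N → ↥lorentzGroup × E4) (φ : ℕ → ℕ) (Mₗ aₗ rₗ : Fin N → ℝ) (moₗ : Fin N → ↥lorentzGroup × E4), StrictMono φ ∧ (∀ n, s (φ n) = ⟨N, M n, a n, r₀ n, mo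 n⟩) ∧ (∀ i, Tendsto (fun n ↦ M n i) atTop (𝓝 (Mₗ i))) ∧ (∀ i, Tendsto (fun n ↦ a n i) atTop (𝓝 (aₗ i))) ∧ (∀ i, Tendsto (fun n ↦ r₀ n i) atTop (𝓝 (rₗ i))) ∧ (∀ i, Tendsto (fun n ↦ (((mo n i).1 : E4 ≃L[ℝ] E4) : E4 →L[ℝ] E4)) atTop (𝓝 (((moₗ i).1 : E4 ≃L[ℝ] E4) : E4 →L[ℝ] E4))) ∧ (∀ i, Tendsto (fun n ↦ (((mo n i).1 : E4 ≃L[ℝ] E4).symm : E4 →L[ℝ] E4)) atTop (𝓝 (((moₗ i).1 : E4 ≃L[ℝ] E4).symm : E4 →L[ℝ] E4))) ∧ InMargins N₀ m₀ χ μ v₀ L₀ N Mₗ aₗ rₗ moₗ :=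
    stub_marginCompactness
  have hT2 : ∀ k : ℕ, ∀ (X : Type) [TopologicalSpace X] [ChartedSpace E3 X] [IsManifold (𝓡 3) (⊤ : ℕ∞) X] [T2Space X] [SecondCountableTopology X] [ConnectedSpace X] (D : InitialDataSet (𝓡 3) X) (𝒟 : VacuumCauchyDevelopment D) (N₀ : ℕ) (m₀ χ μ v₀ L₀ : ℝ), 0 < m₀ → χ < 1 → 0 < μ → 0 < v₀ → ∀ (N : ℕ) (M a r₀ : ℕ → Fin N → ℝ) (mo : ℕ → Fin N → ↥lorentzGroup × E4) (Mₗ aₗ rₗ r₀ₗ : Fin N → ℝ) (moₗ : Fin N → ↥lorentzGroup × E4), (∀ n, InMargins N₀ m₀ χ μ v₀ L₀ N (M n) (a n) (r₀ n) (mo n)) → (∀ i, Tendsto (fun n ↦ M n i) atTop (𝓝 (Mₗ i))) → (∀ i, Tendsto (fun n ↦ a n i) atTop (𝓝 (aₗ i))) → (∀ i, Tendsto (fun n ↦ r₀ n i) atTop (𝓝 (rₗ i))) → (∀ i, Tendsto (fun n ↦ (((mo n i).1 : E4 ≃L[ℝ] E4) : E4 →L[ℝ] E4)) atTop (𝓝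 (((moₗ i).1 : E4 ≃L[ℝ] E4) : E4 →L[ℝ] E4))) → (∀ i, Tendsto (fun n ↦ (((mo n i).1 : E4 ≃L[ℝ] E4).symm : E4 →L[ℝ] E4)) atTop (𝓝 (((moₗ i).1 : E4 ≃L[ℝ] E4).symm : E4 →L[ℝ] E4))) → InMargins N₀ m₀ χ μ v₀ L₀ N Mₗ aₗ rₗ moₗ → (∀ i, r₀ₗ i = rₗ i + μ / 2) → ∀ ε' : ℝ, 0 < ε' → ∃ (n₀ : ℕ) (ε₀ : ℝ), 0 < ε₀ ∧ ∀ n, n₀ ≤ n → ∃ T : ℝ, ∀ τ : ℝ, T ≤ τ → ∀ ε : ℝ, 0 < ε → ε ≤ ε₀ → SlabAt k 𝒟 N (M n) (a n) (r₀ n) (mo n) ε τ → SlabAt k 𝒟 N Mₗ aₗ r₀ₗ moₗ ε' τ :=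
    stub_slabTransferFinal
  obtain ⟨N₀, m₀, χ, μ, v₀, L₀, hm₀, hχ, hμ, hv₀, hε⟩ := hfloat
  have hpos : ∀ n : ℕ, (0 : ℝ) < 1 / ((n : ℝ) + 1) := fun n ↦ by positivity
  choose Nf Mf af rf mof hmarg hrec using fun n : ℕ ↦ hε (1 / ((n : ℝ) + 1)) (hpos n)
  obtain ⟨N, M, a, r₀, mo, φ, Mₗ, aₗ, rₗ, moₗ, hφ, hs, hM, ha, hr, hΛ, hΛs, hmargₗ⟩ :=
    hT1 N₀ m₀ χ μ v₀ L₀ (fun n ↦ ⟨Nf n, Mf n, af n, rf n, mof n⟩) (fun n ↦ hmarg n)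
  -- transport margins and recurrence along the Σ-equalities `hs`
  have transport : ∀ (n : ℕ)
      (p : Σ N : ℕ, (Fin N → ℝ) × (Fin N → ℝ) × (Fin N → ℝ) × (Fin N → ↥lorentzGroup × E4)),
      InMargins N₀ m₀ χ μ v₀ L₀ p.1 p.2.1 p.2.2.1 p.2.2.2.1 p.2.2.2.2 →
      (∀ τ₁ : ℝ, ∃ τ : ℝ, τ₁ ≤ τ ∧
        SlabAt k 𝒟 p.1 p.2.1 p.2.2.1 p.2.2.2.1 p.2.2.2.2 (1 / ((φ n : ℝ) + 1)) τ) →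
      p = ⟨N, M n, a n, r₀ n, mo n⟩ →
      InMargins N₀ m₀ χ μ v₀ L₀ N (M n) (a n) (r₀ n) (mo n) ∧
        ∀ τ₁ : ℝ, ∃ τ : ℝ, τ₁ ≤ τ ∧ SlabAt k 𝒟 N (M n) (a n) (r₀ n) (mo n) (1 / ((φ n : ℝ) + 1)) τ := by
    rintro n p h1 h2 rfl
    exact ⟨h1, h2⟩
  have hboth := fun n ↦ transport n ⟨Nf (φ n), Mf (φ n), af (φ n), rf (φ n), mof (φ n)⟩
    (hmarg (φ n)) (hrec (φ n)) (hs n)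
  have hmargN : ∀ n, InMargins N₀ m₀ χ μ v₀ L₀ N (M n) (a n) (r₀ n) (mo n) := fun n ↦ (hboth n).1
  have hrecN : ∀ n, ∀ τ₁ : ℝ, ∃ τ : ℝ, τ₁ ≤ τ ∧
      SlabAt k 𝒟 N (M n) (a n) (r₀ n) (mo n) (1 / ((φ n : ℝ) + 1)) τ := fun n ↦ (hboth n).2
  have hlim := hmargₗ.2.1
  refine ⟨N, Mₗ, aₗ, fun i ↦ rₗ i + μ / 2, moₗ, fun i ↦ ?_, fun ε' hε' τ₁ ↦ ?_⟩
  · obtain ⟨h1, -, h3, h4, h5, -⟩ := hlim i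
    have hMpos : 0 < Mₗ i := hm₀.trans_le h1
    refine ⟨?_, ?_, ?_⟩
    · show |aₗ i| < Mₗ i
      calc |aₗ i| ≤ χ * Mₗ i := h3
        _ < 1 * Mₗ i := mul_lt_mul_of_pos_right hχ hMpos
        _ = Mₗ i := one_mul _
    · show Kerr.rMinus (Mₗ i) (aₗ i) < rₗ i + μ / 2
      linarith
    · show rₗ i + μ / 2 < Kerr.rPlus (Mₗ i) (aₗ i)
      linarith
  · obtain ⟨n₀, ε₀, hε₀, hstep⟩ := hT2 k X D 𝒟 N₀ m₀ χ μ v₀ L₀ hm₀ hχ hμ hv₀ N M a r₀ mo Mₗ aₗ rₗ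
      (fun i ↦ rₗ i + μ / 2) moₗ hmargN hM ha hr hΛ hΛs hmargₗ (fun _ ↦ rfl) ε' hε'
    -- an index `n ≥ n₀` whose accuracy `1/(φ n + 1)` is below `ε₀`
    obtain ⟨m, hm⟩ := exists_nat_gt (1 / ε₀)
    set n : ℕ := max n₀ m with hn_def
    have hn₀ : n₀ ≤ n := le_max_left _ _
    have hφn : (m : ℝ) ≤ (φ n : ℝ) := by
      exact_mod_cast (le_max_right n₀ m).trans (hφ.id_le n)
    have hacc : 1 / ((φ n : ℝ) + 1) ≤ ε₀ := by
      rw [div_le_iff₀ (by positivity)]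
      have : 1 / ε₀ < (φ n : ℝ) + 1 := by linarith
      have h' : 1 < ε₀ * ((φ n : ℝ) + 1) := by
        have := (div_lt_iff₀ hε₀).1 this
        linarith [this]
      linarith
    obtain ⟨T, hT⟩ := hstep n hn₀
    obtain ⟨τ, hτ, hslab⟩ := hrecN n (max τ₁ T)
    exact ⟨τ, (le_max_left _ _).trans hτ,
      hT τ ((le_max_right _ _).trans hτ) _ (hpos _) hacc hslab⟩

/-- **The crux `KerrBasinCapture` from tame weak cosmic censorship and capture along censored curves.**
Hypothesis `hW` is VERBATIM the body of the registered open item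
`Theses.PhaseMixingCapture.WeakCosmicCensorshipTame` (stmt-FinalStateConjecture-17269); hypothesis `hR` is the
hand-back of `Q_k`-curves along censored tame curves at `Q_k`-exceptional base data, `Q_k` = complete `𝓘⁺` ∧
floating recurrence with margins ∧ the interior lemma (the second registered stub of the line, rev 12). Proof:
composition of tame genericities along curves (`isTameChristodoulouGeneric_of_relative_exceptional`) gives tame
genericity of `Q_k`; monotonicity in the property (`IsTameChristodoulouGeneric.mono`) with charge stabilisation
(`fixedRecurrence_of_floatingRecurrence`) turns it into the crux by name. Both hypotheses are open problems. -/
theorem kerrBasinCapture_of_censorship_of_captureAlongCensoredCurves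
    (hW : ∀ (X : Type) [TopologicalSpace X] [ChartedSpace E3 X] [IsManifold (𝓡 3) (⊤ : ℕ∞) X] [T2Space X] [SecondCountableTopology X] [ConnectedSpace X], InitialDataSet.IsTameChristodoulouGeneric (admissibleVacuumData X) (fun D ↦ (∃ 𝒟 : VacuumCauchyDevelopment D, 𝒟.IsMaximal) ∧ ∀ 𝒟 : VacuumCauchyDevelopment D, 𝒟.IsMaximal → Summit.FinalStateConjecture.HasCompleteNullInfinity 𝒟.toCauchyDevelopment) 1)
    (hR : ∀ k : ℕ, ∀ (X : Type) [TopologicalSpace X] [ChartedSpace E3 X] [IsManifold (𝓡 3) (⊤ : ℕ∞) X] [T2Space X] [SecondCountableTopology X] [ConnectedSpace X] (e : AFEnd X) (F : EuclideanSpace ℝ (Fin 1) → InitialDataSet (𝓡 3) X), InitialDataSet.IsTameDataFamily e 1 F → ((InitialDataSet.IsImmersedAtZero 1 F ∧ Injective F) ∨ ∀ c, F c = F 0) → (∀ c, F c ∈ admissibleVacuumData X) → (∀ c ≠ 0, (∃ 𝒟 : VacuumCauchyDevelopment (F c), 𝒟.IsMaximal) ∧ ∀ 𝒟 : VacuumCauchyDevelopment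 (F c), 𝒟.IsMaximal → Summit.FinalStateConjecture.HasCompleteNullInfinity 𝒟.toCauchyDevelopment) → ¬ (∀ 𝒟 : VacuumCauchyDevelopment (F 0), 𝒟.IsMaximal → Summit.FinalStateConjecture.HasCompleteNullInfinity 𝒟.toCauchyDevelopment ∧ (∃ (N₀ : ℕ) (m₀ χ μ v₀ L₀ : ℝ), 0 < m₀ ∧ χ < 1 ∧ 0 < μ ∧ 0 < v₀ ∧ ∀ ε : ℝ, 0 < ε → ∃ (N : ℕ) (M a r₀ : Fin N → ℝ) (mo : Fin N → ↥lorentzGroup × E4), InMargins N₀ m₀ χ μ v₀ L₀ N M a r₀ mo ∧ ∀ τ₁ : ℝ, ∃ τ : ℝ, τ₁ ≤ τ ∧ SlabAt k 𝒟 N M a r₀ mo ε τ) ∧ (∀ (O : Set 𝒟.carrier) (d : FinalStateDecomposition 𝒟.toSpacetime O 2), (∀ i, Kerr.IsSubextremal (d.mass i) (d.spin i)) → O = Summit.FinalStateConjecture.exteriorOf 𝒟.toCauchyDevelopment d.charted → Summit.FinalStateConjecture.HasExhaustiveCharts d → Summit.FinalStateConjecture.IsFutureOriented d → Summit.FinalStateConjecture.RaysStayInClosure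 𝒟.toCauchyDevelopment O)) → ∃ (e' : AFEnd X) (F' : EuclideanSpace ℝ (Fin 1) → InitialDataSet (𝓡 3) X), InitialDataSet.IsTameDataFamily e' 1 F' ∧ F' 0 = F 0 ∧ Injective F' ∧ InitialDataSet.IsImmersedAtZero 1 F' ∧ (∀ c, F' c ∈ admissibleVacuumData X) ∧ ∀ c ≠ 0, ∀ 𝒟 : VacuumCauchyDevelopment (F' c), 𝒟.IsMaximal → Summit.FinalStateConjecture.HasCompleteNullInfinity 𝒟.toCauchyDevelopment ∧ (∃ (N₀ : ℕ) (m₀ χ μ v₀ L₀ : ℝ), 0 < m₀ ∧ χ < 1 ∧ 0 < μ ∧ 0 < v₀ ∧ ∀ ε : ℝ, 0 < ε → ∃ (N : ℕ) (M a r₀ : Fin N → ℝ) (mo : Fin N → ↥lorentzGroup × E4), InMargins N₀ m₀ χ μ v₀ L₀ N M a r₀ mo ∧ ∀ τ₁ : ℝ, ∃ τ : ℝ, τ₁ ≤ τ ∧ SlabAt k 𝒟 N M a r₀ mo ε τ) ∧ (∀ (O : Set 𝒟.carrier) (d : FinalStateDecomposition 𝒟.toSpacetime O 2), (∀ i, Kerr.IsSubextremal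 (d.mass i) (d.spin i)) → O = Summit.FinalStateConjecture.exteriorOf 𝒟.toCauchyDevelopment d.charted → Summit.FinalStateConjecture.HasExhaustiveCharts d → Summit.FinalStateConjecture.IsFutureOriented d → Summit.FinalStateConjecture.RaysStayInClosure 𝒟.toCauchyDevelopment O)) :
    Summit.FinalStateConjecture.FinalStateConjecture.Theses.KerrnessPropagates.KerrBasinCapture := by
  intro k X _ _ _ _ _ _
  have hgen : InitialDataSet.IsTameChristodoulouGeneric (admissibleVacuumData X)
      (fun D ↦ ∀ 𝒟 : VacuumCauchyDevelopment D, 𝒟.IsMaximal → Summit.FinalStateConjecture.HasCompleteNullInfinity 𝒟.toCauchyDevelopment ∧ (∃ (N₀ : ℕ) (m₀ χ μ v₀ L₀ : ℝ), 0 < m₀ ∧ χ < 1 ∧ 0 < μ ∧ 0 < v₀ ∧ ∀ ε : ℝ, 0 < ε → ∃ (N : ℕ) (M a r₀ : Fin N → ℝ) (mo : Fin N → ↥lorentzGroup × E4), InMargins N₀ m₀ χ μ v₀ L₀ N M a r₀ mo ∧ ∀ τ₁ : ℝ, ∃ τ : ℝ, τ₁ ≤ τ ∧ SlabAt k 𝒟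 N M a r₀ mo ε τ) ∧ (∀ (O : Set 𝒟.carrier) (d : FinalStateDecomposition 𝒟.toSpacetime O 2), (∀ i, Kerr.IsSubextremal (d.mass i) (d.spin i)) → O = Summit.FinalStateConjecture.exteriorOf 𝒟.toCauchyDevelopment d.charted → Summit.FinalStateConjecture.HasExhaustiveCharts d → Summit.FinalStateConjecture.IsFutureOriented d → Summit.FinalStateConjecture.RaysStayInClosure 𝒟.toCauchyDevelopment O)) 1 :=
    InitialDataSet.isTameChristodoulouGeneric_of_relative_exceptional
      (fun d hd ↦ exists_isSoleEnd_of_mem_admissibleVacuumData hd) (hW X)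
      (fun e F hF hdich hadm hQ hexc ↦ hR k X e F hF hdich hadm hQ hexc)
  refine InitialDataSet.IsTameChristodoulouGeneric.mono hgen ?_
  intro D hD hQ 𝒟 h𝒟
  exact ⟨(hQ 𝒟 h𝒟).1, fixedRecurrence_of_floatingRecurrence k 𝒟 (hQ 𝒟 h𝒟).2.1, (hQ 𝒟 h𝒟).2.2⟩

/-- **The crux `KerrBasinCapture` from tame weak cosmic censorship, RECURRENCE ALONG CENSORED CURVES and THE INTERIOR
LEMMA ALONG RECURRENT CURVES** (the line's rev-13 cut, which isolates the interior lemma). Hypothesis `hW` is VERBATIM the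
body of the registered open item `Theses.PhaseMixingCapture.WeakCosmicCensorshipTame` (stmt-FinalStateConjecture-17269);
`hR` hands back, along every tame curve of admissible data whose members off `0` are censored and whose base datum is
exceptional for `P₁ k` = "every MGHD has complete `𝓘⁺` and recurs with floating charges in one margin family in the one-chart
`Cᵏ` slab sense", a tame injective immersed admissible curve (on some end) whose members off `0` satisfy `P₁ k` (the
final state of censored developments, recurrence form); `hI` hands back, along every tame curve whose members off `0`
satisfy `P₁ k` and whose base datum is exceptional for `Q_k = P₁ k ∧` interior lemma, such a curve whose members off `0`
satisfy `Q_k` (generically, an honestly charted exterior hides no future-complete null ray from `Σ`; topology-sensitive,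
the crux quantifying over all one-ended `X`). Proof: two compositions along curves
(`isTameChristodoulouGeneric_of_relative_exceptional`) give tame genericity of `Q_k`; then monotonicity with charge
stabilisation (`fixedRecurrence_of_floatingRecurrence`). Each hypothesis is, given the previous ones, EQUIVALENT to the
tame genericity it produces (`isTameChristodoulouGeneric_iff_relative_exceptional`), so the cut loses nothing; all three
are open problems — this theorem is the glue. -/
theorem kerrBasinCapture_of_censorship_of_recurrence_of_interiorLemma
    (hW : ∀ (X : Type) [TopologicalSpace X] [ChartedSpace E3 X] [IsManifold (𝓡 3) (⊤ : ℕ∞) X] [T2Space X] [SecondCountableTopology X] [ConnectedSpace X], InitialDataSet.IsTameChristodoulouGeneric (admissibleVacuumData X) (fun D ↦ ((∃ 𝒟 : VacuumCauchyDevelopment D, 𝒟.IsMaximal) ∧ ∀ 𝒟 : VacuumCauchyDevelopment D, 𝒟.IsMaximal → Summit.FinalStateConjecture.HasCompleteNullInfinity 𝒟.toCauchyDevelopment)) 1)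
    (hR : ∀ k : ℕ, ∀ (X : Type) [TopologicalSpace X] [ChartedSpace E3 X] [IsManifold (𝓡 3) (⊤ : ℕ∞) X] [T2Space X] [SecondCountableTopology X] [ConnectedSpace X] (e : AFEnd X) (F : EuclideanSpace ℝ (Fin 1) → InitialDataSet (𝓡 3) X), InitialDataSet.IsTameDataFamily e 1 F → ((InitialDataSet.IsImmersedAtZero 1 F ∧ Injective F) ∨ ∀ c, F c = F 0) → (∀ c, F c ∈ admissibleVacuumData X) → (∀ c ≠ 0, ((∃ 𝒟 : VacuumCauchyDevelopment (F c), 𝒟.IsMaximal) ∧ ∀ 𝒟 : VacuumCauchyDevelopment (F c), 𝒟.IsMaximal → Summit.FinalStateConjecture.HasCompleteNullInfinity 𝒟.toCauchyDevelopment)) → ¬ (∀ 𝒟 : VacuumCauchyDevelopment (F 0), 𝒟.IsMaximal → Summit.FinalStateConjecture.HasCompleteNullInfinity 𝒟.toCauchyDevelopment ∧ (∃ (N₀ : ℕ) (m₀ χ μ v₀ L₀ : ℝ), 0 < m₀ ∧ χ < 1 ∧ 0 < μ ∧ 0 < v₀ ∧ ∀ ε : ℝ, 0 < ε → ∃ (N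 : ℕ) (M a r₀ : Fin N → ℝ) (mo : Fin N → ↥lorentzGroup × E4), InMargins N₀ m₀ χ μ v₀ L₀ N M a r₀ mo ∧ ∀ τ₁ : ℝ, ∃ τ : ℝ, τ₁ ≤ τ ∧ SlabAt k 𝒟 N M a r₀ mo ε τ)) → ∃ (e' : AFEnd X) (F' : EuclideanSpace ℝ (Fin 1) → InitialDataSet (𝓡 3) X), InitialDataSet.IsTameDataFamily e' 1 F' ∧ F' 0 = F 0 ∧ Injective F' ∧ InitialDataSet.IsImmersedAtZero 1 F' ∧ (∀ c, F' c ∈ admissibleVacuumData X) ∧ ∀ c ≠ 0, (∀ 𝒟 : VacuumCauchyDevelopment (F' c), 𝒟.IsMaximal → Summit.FinalStateConjecture.HasCompleteNullInfinity 𝒟.toCauchyDevelopment ∧ (∃ (N₀ : ℕ) (m₀ χ μ v₀ L₀ : ℝ), 0 < m₀ ∧ χ < 1 ∧ 0 < μ ∧ 0 < v₀ ∧ ∀ ε : ℝ, 0 < ε → ∃ (N : ℕ) (M a r₀ : Fin N → ℝ) (mo : Fin N → ↥lorentzGroup × E4), InMargins N₀ m₀ χ μ v₀ L₀ N M a r₀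 mo ∧ ∀ τ₁ : ℝ, ∃ τ : ℝ, τ₁ ≤ τ ∧ SlabAt k 𝒟 N M a r₀ mo ε τ)))
    (hI : ∀ k : ℕ, ∀ (X : Type) [TopologicalSpace X] [ChartedSpace E3 X] [IsManifold (𝓡 3) (⊤ : ℕ∞) X] [T2Space X] [SecondCountableTopology X] [ConnectedSpace X] (e : AFEnd X) (F : EuclideanSpace ℝ (Fin 1) → InitialDataSet (𝓡 3) X), InitialDataSet.IsTameDataFamily e 1 F → ((InitialDataSet.IsImmersedAtZero 1 F ∧ Injective F) ∨ ∀ c, F c = F 0) → (∀ c, F c ∈ admissibleVacuumData X) → (∀ c ≠ 0, (∀ 𝒟 : VacuumCauchyDevelopment (F c), 𝒟.IsMaximal → Summit.FinalStateConjecture.HasCompleteNullInfinity 𝒟.toCauchyDevelopment ∧ (∃ (N₀ : ℕ) (m₀ χ μ v₀ L₀ : ℝ), 0 < m₀ ∧ χ < 1 ∧ 0 < μ ∧ 0 < v₀ ∧ ∀ ε : ℝ, 0 < ε → ∃ (N : ℕ) (M a r₀ : Fin N → ℝ) (mo : Fin N → ↥lorentzGroup × E4), InMargins N₀ m₀ χ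 μ v₀ L₀ N M a r₀ mo ∧ ∀ τ₁ : ℝ, ∃ τ : ℝ, τ₁ ≤ τ ∧ SlabAt k 𝒟 N M a r₀ mo ε τ))) → ¬ (∀ 𝒟 : VacuumCauchyDevelopment (F 0), 𝒟.IsMaximal → Summit.FinalStateConjecture.HasCompleteNullInfinity 𝒟.toCauchyDevelopment ∧ (∃ (N₀ : ℕ) (m₀ χ μ v₀ L₀ : ℝ), 0 < m₀ ∧ χ < 1 ∧ 0 < μ ∧ 0 < v₀ ∧ ∀ ε : ℝ, 0 < ε → ∃ (N : ℕ) (M a r₀ : Fin N → ℝ) (mo : Fin N → ↥lorentzGroup × E4), InMargins N₀ m₀ χ μ v₀ L₀ N M a r₀ mo ∧ ∀ τ₁ : ℝ, ∃ τ : ℝ, τ₁ ≤ τ ∧ SlabAt k 𝒟 N M a r₀ mo ε τ) ∧ (∀ (O : Set 𝒟.carrier) (d : FinalStateDecomposition 𝒟.toSpacetime O 2), (∀ i, Kerr.IsSubextremal (d.mass i) (d.spin i)) → O = Summit.FinalStateConjecture.exteriorOf 𝒟.toCauchyDevelopment d.charted → Summit.FinalStateConjecture.HasExhaustiveCharts d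 → Summit.FinalStateConjecture.IsFutureOriented d → Summit.FinalStateConjecture.RaysStayInClosure 𝒟.toCauchyDevelopment O)) → ∃ (e' : AFEnd X) (F' : EuclideanSpace ℝ (Fin 1) → InitialDataSet (𝓡 3) X), InitialDataSet.IsTameDataFamily e' 1 F' ∧ F' 0 = F 0 ∧ Injective F' ∧ InitialDataSet.IsImmersedAtZero 1 F' ∧ (∀ c, F' c ∈ admissibleVacuumData X) ∧ ∀ c ≠ 0, (∀ 𝒟 : VacuumCauchyDevelopment (F' c), 𝒟.IsMaximal → Summit.FinalStateConjecture.HasCompleteNullInfinity 𝒟.toCauchyDevelopment ∧ (∃ (N₀ : ℕ) (m₀ χ μ v₀ L₀ : ℝ), 0 < m₀ ∧ χ < 1 ∧ 0 < μ ∧ 0 < v₀ ∧ ∀ ε : ℝ, 0 < ε → ∃ (N : ℕ) (M a r₀ : Fin N → ℝ) (mo : Fin N → ↥lorentzGroup × E4), InMargins N₀ m₀ χ μ v₀ L₀ N M a r₀ mo ∧ ∀ τ₁ : ℝ, ∃ τ : ℝ, τ₁ ≤ τ ∧ SlabAt k 𝒟 N M a r₀ mo ε τ) ∧ (∀ (O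 : Set 𝒟.carrier) (d : FinalStateDecomposition 𝒟.toSpacetime O 2), (∀ i, Kerr.IsSubextremal (d.mass i) (d.spin i)) → O = Summit.FinalStateConjecture.exteriorOf 𝒟.toCauchyDevelopment d.charted → Summit.FinalStateConjecture.HasExhaustiveCharts d → Summit.FinalStateConjecture.IsFutureOriented d → Summit.FinalStateConjecture.RaysStayInClosure 𝒟.toCauchyDevelopment O))) :
    Summit.FinalStateConjecture.FinalStateConjecture.Theses.KerrnessPropagates.KerrBasinCapture := by
  intro k X _ _ _ _ _ _
  have hEnd : ∀ d ∈ admissibleVacuumData X, ∃ e : AFEnd X, e.IsSoleEnd ∧ ∃ M : ℝ, e.IsStronglyAsymptoticallyFlatDR d M :=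
    fun d hd ↦ exists_isSoleEnd_of_mem_admissibleVacuumData hd
  have h1 : InitialDataSet.IsTameChristodoulouGeneric (admissibleVacuumData X)
      (fun D ↦ ∀ 𝒟 : VacuumCauchyDevelopment D, 𝒟.IsMaximal → Summit.FinalStateConjecture.HasCompleteNullInfinity 𝒟.toCauchyDevelopment ∧ (∃ (N₀ : ℕ) (m₀ χ μ v₀ L₀ : ℝ), 0 < m₀ ∧ χ < 1 ∧ 0 < μ ∧ 0 < v₀ ∧ ∀ ε : ℝ, 0 < ε → ∃ (N : ℕ) (M a r₀ : Fin N → ℝ) (mo : Fin N → ↥lorentzGroup × E4), InMargins N₀ m₀ χ μ v₀ L₀ N M a r₀ mo ∧ ∀ τ₁ : ℝ, ∃ τ : ℝ, τ₁ ≤ τ ∧ SlabAt k 𝒟 N M a r₀ mo ε τ)) 1 :=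
    InitialDataSet.isTameChristodoulouGeneric_of_relative_exceptional hEnd (hW X)
      (fun e F hF hdich hadm hQ hexc ↦ hR k X e F hF hdich hadm hQ hexc)
  have h2 : InitialDataSet.IsTameChristodoulouGeneric (admissibleVacuumData X)
      (fun D ↦ ∀ 𝒟 : VacuumCauchyDevelopment D, 𝒟.IsMaximal → Summit.FinalStateConjecture.HasCompleteNullInfinity 𝒟.toCauchyDevelopment ∧ (∃ (N₀ : ℕ) (m₀ χ μ v₀ L₀ : ℝ), 0 < m₀ ∧ χ < 1 ∧ 0 < μ ∧ 0 < v₀ ∧ ∀ ε : ℝ, 0 < ε → ∃ (N : ℕ) (M a r₀ : Fin N → ℝ) (mo : Fin N → ↥lorentzGroup × E4), InMargins N₀ m₀ χ μ v₀ L₀ N M a r₀ mo ∧ ∀ τ₁ : ℝ, ∃ τ : ℝ, τ₁ ≤ τ ∧ SlabAt k 𝒟 N M a r₀ mo ε τ) ∧ (∀ (O : Set 𝒟.carrier) (d : FinalStateDecomposition 𝒟.toSpacetime O 2), (∀ i, Kerr.IsSubextremal (d.mass i) (d.spin i)) → O = Summit.FinalStateConjecture.exteriorOf 𝒟.toCauchyDevelopment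 d.charted → Summit.FinalStateConjecture.HasExhaustiveCharts d → Summit.FinalStateConjecture.IsFutureOriented d → Summit.FinalStateConjecture.RaysStayInClosure 𝒟.toCauchyDevelopment O)) 1 :=
    InitialDataSet.isTameChristodoulouGeneric_of_relative_exceptional hEnd h1
      (fun e F hF hdich hadm hQ hexc ↦ hI k X e F hF hdich hadm hQ hexc)
  refine InitialDataSet.IsTameChristodoulouGeneric.mono h2 ?_
  intro D hD hQ 𝒟 h𝒟
  exact ⟨(hQ 𝒟 h𝒟).1, fixedRecurrence_of_floatingRecurrence k 𝒟 (hQ 𝒟 h𝒟).2.1, (hQ 𝒟 h𝒟).2.2⟩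

end Summit.FinalStateConjecture.FinalStateConjecture.Theorems.KerrnessPropagates.KerrBasinCapture
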